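import Literature.Probability.LatticeModels.LineTouching
import Literature.Probability.LatticeModels.HalfPlaneStates
import HarnessLib

/-!
# Stochastic domination from the absence of (+,−)-percolation (Georgii–Higuchi 2000, Prop. 5.1)

Topic `Probability/LatticeModels`. The last step of Georgii–Higuchi's proof of the
Aizenman–Higuchi theorem (J. Math. Phys. 41 (2000), proof of Prop. 5.1, p. 16, "as in
Aizenman [1]"): if, for two Gibbs measures `μ, μ̂ ∈ 𝒢(β, 0)` on `ℤ²`, in the duplicated system
`ν̂ = μ ⊗ μ̂` every finite square is almost surely surrounded by a `≤∗`circuit (a `∗`-circuit of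
sites with `ω(x) ≤ ω̂(x)`), then `μ ≼ μ̂`: "Let `Γ` be the interior of the largest such
`≤∗`circuit … using the strong Markov property of `ν̂` and the fact that `μ^ω_Γ ≼ μ^{ω̂}_Γ`,
`μ(f) = ν̂(f ⊗ 1) ≤ ∫_{Γ ≠ ∅} μ^ω_Γ(f) dν̂ + ε ≤ ∫ μ^{ω'}_Γ(f) dν̂ + ε = ν̂(1 ⊗ f) + ε = μ̂(f) + ε`."

We prove this circuit-free, with the exploration volume `Γ_N(ω, ω̂) = explVolume` of the box
`Λ_N` explored from outside through the **bad** sites `{ω = +1, ω̂ = -1}` (`ExplorationVolume`):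
its lattice outer boundary consists of good sites (`ω ≤ ω̂`), it is determined by the pair off
`Γ_N`, and the hypothesis "no infinite lattice cluster of bad sites" makes `Δ ⊆ Γ_N` likely.

* `badConfig`, `badVolume` — the bad sites of a pair as a spin configuration, and `Γ_N`;
* `measurableSet_badVolume_eq_left/right` — sections of `{Γ_N = G}` are `𝓕_{Gᶜ}`-measurable;
* `tendsto_measure_not_subset_badVolume` — `ν̂(Δ ⊄ Γ_N) → 0`;
* **`lintegral_le_of_no_bad_percolation`**, **`integral_le_of_no_bad_percolation`** — `μ ≼ μ̂`
  on increasing local observables;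
* **`eq_of_no_bad_percolation`** — with the hypothesis in both directions, `μ = μ̂`.

## References

* H.-O. Georgii, Y. Higuchi, J. Math. Phys. 41 (2000), proof of Prop. 5.1 (p. 16)
  [GeorgiiHiguchi2000].
* M. Aizenman, Comm. Math. Phys. 73 (1980) 83–94 (the original argument).
-/

noncomputable section

open MeasureTheory Filter Topology Finset
open Literature.Probability.Percolation
open scoped ENNReal

namespace Literature.Probability.LatticeModels

variable {β : ℝ}

/-! ### Bad sites and the explored volume -/

/-- The bad sites `{ω = +1, ω̂ = -1}` of a pair, as a spin configuration (`+1` = bad). [cite: GeorgiiHiguchi2000, Lemma 5.5] -/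
def badConfig (p : SpinConfig (Site 2) × SpinConfig (Site 2)) : SpinConfig (Site 2) :=
  fun z => if p.1 z = 1 ∧ p.2 z = -1 then 1 else -1

/-- `z` is bad iff `ω z = +1` and `ω̂ z = -1`. [folklore] -/
theorem mem_spinSites_badConfig {p : SpinConfig (Site 2) × SpinConfig (Site 2)} {z : Site 2} :
    z ∈ spinSites 1 (badConfig p) ↔ p.1 z = 1 ∧ p.2 z = -1 := by
  rw [mem_spinSites, badConfig]
  by_cases h : p.1 z = 1 ∧ p.2 z = -1 <;> simp [h]

/-- Good sites: `ω z ≤ ω̂ z`. [folklore] -/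
theorem le_of_not_mem_spinSites_badConfig {p : SpinConfig (Site 2) × SpinConfig (Site 2)} {z : Site 2}
    (h : z ∉ spinSites 1 (badConfig p)) : p.1 z ≤ p.2 z := by
  rw [mem_spinSites_badConfig, not_and_or] at h
  rcases Int.units_eq_one_or (p.1 z) with h1 | h1 <;> rcases Int.units_eq_one_or (p.2 z) with h2 | h2 <;>
    rw [h1, h2] <;> first | exact le_rfl | exact neg_one_le_intUnits _ | (exfalso; exact h.elim (· h1) (· h2))

/-- `badConfig` is measurable. [folklore] -/
theorem measurable_badConfig : Measurable badConfig := by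
  refine measurable_pi_lambda _ fun z => ?_
  have h1 : MeasurableSet {p : SpinConfig (Site 2) × SpinConfig (Site 2) | p.1 z = 1} :=
    measurableSet_eq_fun ((measurable_pi_apply z).comp measurable_fst) measurable_const
  have h2 : MeasurableSet {p : SpinConfig (Site 2) × SpinConfig (Site 2) | p.2 z = -1} :=
    measurableSet_eq_fun ((measurable_pi_apply z).comp measurable_snd) measurable_const
  exact Measurable.ite (h1.inter h2) measurable_const measurable_const

/-- **The explored volume** `Γ_N(ω, ω̂)`: the sites of `Λ_N` not reached from outside `Λ_N` by
lattice paths of bad sites. [cite: GeorgiiHiguchi2000, Prop. 5.1 (proof)] -/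
def badVolume (N : ℕ) (p : SpinConfig (Site 2) × SpinConfig (Site 2)) : Finset (Site 2) :=
  explVolume (zdGraph 2) (box 2 N) (spinSites 1 (badConfig p))

/-- `{Γ_N = G}` depends only on the pair on `Λ_N ∖ G`. [cite: GeorgiiHiguchi2000, Prop. 5.1 (proof)] -/
theorem badVolume_eq_iff_of_eqOn {N : ℕ} {G : Finset (Site 2)} {p q : SpinConfig (Site 2) × SpinConfig (Site 2)}
    (h : ∀ z ∈ box 2 N \ G, p.1 z = q.1 z ∧ p.2 z = q.2 z) : badVolume N p = G ↔ badVolume N q = G := by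
  unfold badVolume
  rw [explVolume_eq_iff (T := spinSites 1 (badConfig p)), explVolume_eq_iff (T := spinSites 1 (badConfig q))]
  have hT : spinSites 1 (badConfig p) ∩ (↑(box 2 N) \ ↑G) = spinSites 1 (badConfig q) ∩ (↑(box 2 N) \ ↑G) := by
    ext z
    simp only [Set.mem_inter_iff, mem_spinSites_badConfig, Set.mem_sdiff, Finset.mem_coe]
    constructor
    · rintro ⟨⟨h1, h2⟩, hzΛ, hzG⟩
      obtain ⟨e1, e2⟩ := h z (Finset.mem_sdiff.2 ⟨hzΛ, hzG⟩)
      exact ⟨⟨by rw [← e1]; exact h1, by rw [← e2]; exact h2⟩, hzΛ, hzG⟩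
    · rintro ⟨⟨h1, h2⟩, hzΛ, hzG⟩
      obtain ⟨e1, e2⟩ := h z (Finset.mem_sdiff.2 ⟨hzΛ, hzG⟩)
      exact ⟨⟨by rw [e1]; exact h1, by rw [e2]; exact h2⟩, hzΛ, hzG⟩
  rw [hT]

/-- The left section `{ω | Γ_N(ω, ω̂) = G}` is `𝓕_{Gᶜ}`-measurable. [cite: GeorgiiHiguchi2000, Prop. 5.1 (proof)] -/
theorem measurableSet_badVolume_eq_left (N : ℕ) (G : Finset (Site 2)) (ω' : SpinConfig (Site 2)) :
    MeasurableSet[cylinderEvents (X := fun _ : Site 2 => ℤˣ) ((↑G : Set (Site 2))ᶜ)]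
      {ω : SpinConfig (Site 2) | badVolume N (ω, ω') = G} := by
  have hK : MeasurableSet[cylinderEvents (X := fun _ : Site 2 => ℤˣ) (↑(box 2 N \ G) : Set (Site 2))]
      {ω : SpinConfig (Site 2) | badVolume N (ω, ω') = G} :=
    measurableSet_cylinderEvents_of_forall_eq fun ω ω'' hωω' =>
      badVolume_eq_iff_of_eqOn fun z hz => ⟨hωω' z hz, rfl⟩
  refine cylinderEvents_mono (fun x hx => ?_) _ hK
  simp only [Finset.coe_sdiff, Set.mem_sdiff, Finset.mem_coe] at hx
  exact hx.2

/-- The right section `{ω̂ | Γ_N(ω, ω̂) = G}` is `𝓕_{Gᶜ}`-measurable. [cite: GeorgiiHiguchi2000, Prop. 5.1 (proof)] -/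
theorem measurableSet_badVolume_eq_right (N : ℕ) (G : Finset (Site 2)) (ω : SpinConfig (Site 2)) :
    MeasurableSet[cylinderEvents (X := fun _ : Site 2 => ℤˣ) ((↑G : Set (Site 2))ᶜ)]
      {ω' : SpinConfig (Site 2) | badVolume N (ω, ω') = G} := by
  have hK : MeasurableSet[cylinderEvents (X := fun _ : Site 2 => ℤˣ) (↑(box 2 N \ G) : Set (Site 2))]
      {ω' : SpinConfig (Site 2) | badVolume N (ω, ω') = G} :=
    measurableSet_cylinderEvents_of_forall_eq fun ω' ω'' hωω' =>
      badVolume_eq_iff_of_eqOn fun z hz => ⟨rfl, hωω' z hz⟩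
  refine cylinderEvents_mono (fun x hx => ?_) _ hK
  simp only [Finset.coe_sdiff, Set.mem_sdiff, Finset.mem_coe] at hx
  exact hx.2

/-- `{Γ_N = G}` is measurable in the pair. [folklore] -/
theorem measurableSet_badVolume_eq (N : ℕ) (G : Finset (Site 2)) :
    MeasurableSet {p : SpinConfig (Site 2) × SpinConfig (Site 2) | badVolume N p = G} := by
  classical
  -- restriction of both layers to the finite set `K = Λ_N ∖ G`
  set K := box 2 N \ G with hK
  set r : SpinConfig (Site 2) × SpinConfig (Site 2) → (↥K → ℤˣ × ℤˣ) := fun p z => (p.1 z, p.2 z) with hr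
  have hrm : Measurable r := by
    refine measurable_pi_lambda _ fun z => ?_
    exact ((measurable_pi_apply (z : Site 2)).comp measurable_fst).prodMk
      ((measurable_pi_apply (z : Site 2)).comp measurable_snd)
  have heq : {p : SpinConfig (Site 2) × SpinConfig (Site 2) | badVolume N p = G} =
      r ⁻¹' (r '' {p | badVolume N p = G}) := by
    ext p
    simp only [Set.mem_preimage, Set.mem_image, Set.mem_setOf_eq]
    constructor
    · exact fun h => ⟨p, h, rfl⟩
    · rintro ⟨q, hq, hqp⟩
      refine (badVolume_eq_iff_of_eqOn fun z hz => ?_).1 hq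
      have := congr_fun hqp ⟨z, hz⟩
      simp only [hr, Prod.mk.injEq] at this
      exact ⟨this.1, this.2⟩
  rw [heq]
  exact hrm ((Set.to_countable _).measurableSet)

/-- On `{Γ_N = G}`, the lattice outer boundary of `G` is good: `ω ≤ ω̂` there. [cite: GeorgiiHiguchi2000, Prop. 5.1 (proof)] -/
theorem le_of_mem_outerBoundary_badVolume {N : ℕ} {p : SpinConfig (Site 2) × SpinConfig (Site 2)}
    {z : Site 2} (hz : z ∈ outerBoundary (zdGraph 2) (badVolume N p)) : p.1 z ≤ p.2 z := by
  rw [mem_outerBoundary_iff] at hz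
  obtain ⟨hzG, y, hy, hadj⟩ := hz
  exact le_of_not_mem_spinSites_badConfig (not_mem_of_adj_explVolume hy hzG hadj.symm).2

/-! ### `Δ ⊆ Γ_N` with high probability -/

/-- Exitability shrinks with the volume: exitable in `Λ_{N+1}` implies exitable in `Λ_N`. [folklore] -/
theorem exitable_mono_box {T : Set (Site 2)} {N : ℕ} {y : Site 2} (h : Exitable (zdGraph 2) (box 2 (N + 1)) T y)
    (hy : y ∈ box 2 N) : Exitable (zdGraph 2) (box 2 N) T y := by
  induction h with
  | @base y z hyΛ hz hadj =>
    exact .base hy (fun hz' => hz (box_mono 2 (Nat.le_succ N) hz')) hadj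
  | @step y t hyΛ ht hadj _ ih =>
    by_cases htN : t ∈ box 2 N
    · exact .step hy ht hadj (ih htN)
    · exact .base hy htN hadj

/-- `Δ ⊄ Γ_N` is decreasing in `N`. [folklore] -/
theorem not_subset_badVolume_anti (Δ : Finset (Site 2)) (p : SpinConfig (Site 2) × SpinConfig (Site 2)) {N : ℕ}
    (hΔ : Δ ⊆ box 2 N) (h : ¬ Δ ⊆ badVolume (N + 1) p) : ¬ Δ ⊆ badVolume N p := by
  intro hsub
  apply h
  intro y hy
  have hyN := hsub hy
  unfold badVolume at hyN ⊢
  rw [mem_explVolume_iff] at hyN ⊢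
  exact ⟨box_mono 2 (Nat.le_succ N) (hΔ hy), fun hex => hyN.2 (exitable_mono_box hex (hΔ hy))⟩

/-- A site that is exitable from every box has a neighbour with an infinite bad cluster. [cite: GeorgiiHiguchi2000, Prop. 5.1 (proof: "with probability at least 1 − ε such a circuit can be found in a large square")] -/
theorem exists_infinite_of_forall_exitable {p : SpinConfig (Site 2) × SpinConfig (Site 2)} {y : Site 2}
    (h : ∀ N : ℕ, y ∈ box 2 N → Exitable (zdGraph 2) (box 2 N) (spinSites 1 (badConfig p)) y) :
    ∃ t, (siteCluster (zdGraph 2) (spinSites 1 (badConfig p)) t).Infinite := by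
  classical
  by_contra hno
  push Not at hno
  -- a box containing `y`, its neighbours, and all their (finite) clusters
  obtain ⟨M₀, hM₀'⟩ := exists_forall_subset_box 2 (insert y ((zdGraph 2).neighborFinset y))
  have hM₀ := hM₀' M₀ le_rfl
  have hfin : ((zdGraph 2).neighborFinset y : Set (Site 2)).Finite := Finset.finite_toSet _
  obtain ⟨M₁, hM₁⟩ : ∃ M₁ : ℕ, ∀ t ∈ (zdGraph 2).neighborFinset y, ∀ w ∈ siteCluster (zdGraph 2) (spinSites 1 (badConfig p)) t,
      w ∈ box 2 M₁ := by
    have hU : (⋃ t ∈ ((zdGraph 2).neighborFinset y : Set (Site 2)), siteCluster (zdGraph 2) (spinSites 1 (badConfig p)) t).Finite :=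
      hfin.biUnion fun t _ => hno t
    obtain ⟨M₁, hM₁⟩ := exists_forall_subset_box 2 hU.toFinset
    refine ⟨M₁, fun t ht w hw => hM₁ M₁ le_rfl (hU.mem_toFinset.2 (Set.mem_biUnion (Finset.mem_coe.2 ht) hw))⟩
  set M := max M₀ M₁ + 1 with hM
  have hyM : y ∈ box 2 M := box_mono 2 (by omega) (hM₀ (Finset.mem_insert_self _ _))
  have hex := h M hyM
  -- the exit path from `y` leaves `Λ_M` through a bad cluster of a neighbour: too far
  have hfar : ∀ z, (zdGraph 2).Adj y z → z ∈ box 2 M := fun z hz =>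
    box_mono 2 (by omega) (hM₀ (Finset.mem_insert_of_mem ((SimpleGraph.mem_neighborFinset _ _ _).2 hz)))
  have hyV : y ∉ explVolume (zdGraph 2) (box 2 M) (spinSites 1 (badConfig p)) := fun h' =>
    (mem_explVolume_iff.1 h').2 hex
  obtain ⟨t, t', ht, -, hyt, ht', ht'bd, hreach⟩ :=
    exists_reachable_innerBoundary_of_not_mem_explVolume hyM hyV hfar
  have ht'cl : t' ∈ siteCluster (zdGraph 2) (spinSites 1 (badConfig p)) t :=
    ⟨ht, ht', hreach.mono (siteOpenGraph_mono _ Set.inter_subset_left)⟩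
  have ht'M₁ := hM₁ t ((SimpleGraph.mem_neighborFinset _ _ _).2 hyt) t' ht'cl
  -- `t'` is on the inner boundary of `Λ_M`, hence not in `Λ_{M-1} ⊇ Λ_{M₁}`
  rw [mem_innerBoundary_iff] at ht'bd
  obtain ⟨-, z, hz, hzadj⟩ := ht'bd
  apply hz
  have := mem_box_succ_of_zdGraph_adj (d := 2) (box_mono 2 (le_max_right M₀ M₁) ht'M₁) hzadj
  rwa [hM]

/-- **`ν̂(Δ ⊄ Γ_N) → 0`** when there is almost surely no infinite lattice cluster of bad sites. [cite: GeorgiiHiguchi2000, Prop. 5.1 (proof)] -/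
theorem tendsto_measure_not_subset_badVolume (ν : Measure (SpinConfig (Site 2) × SpinConfig (Site 2)))
    [IsFiniteMeasure ν] (hT : ∀ᵐ p ∂ν, ∀ t, ¬ (siteCluster (zdGraph 2) (spinSites 1 (badConfig p)) t).Infinite)
    (Δ : Finset (Site 2)) :
    Tendsto (fun N => ν {p | ¬ Δ ⊆ badVolume N p}) atTop (𝓝 0) := by
  classical
  obtain ⟨N₀, hN₀'⟩ := exists_forall_subset_box 2 Δ
  have hN₀ := hN₀' N₀ le_rfl
  -- the shifted sequence is decreasing with null intersection
  have hmeas : ∀ N, MeasurableSet {p : SpinConfig (Site 2) × SpinConfig (Site 2) | ¬ Δ ⊆ badVolume N p} := by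
    intro N
    have : {p : SpinConfig (Site 2) × SpinConfig (Site 2) | ¬ Δ ⊆ badVolume N p} =
        (⋃ G ∈ ((box 2 N).powerset.filter fun G => Δ ⊆ G), {p | badVolume N p = G})ᶜ := by
      ext p
      simp only [Set.mem_setOf_eq, Set.mem_compl_iff, Set.mem_iUnion, Finset.mem_filter, Finset.mem_powerset,
        exists_prop, not_exists, not_and]
      constructor
      · intro h G hG hpG; exact h (hpG ▸ hG.2)
      · intro h hΔ; exact h (badVolume N p) ⟨explVolume_subset _ _, hΔ⟩ rfl
    rw [this]
    exact (MeasurableSet.biUnion (Set.to_countable _) fun G _ => measurableSet_badVolume_eq N G).compl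
  have hanti : ∀ N, {p : SpinConfig (Site 2) × SpinConfig (Site 2) | ¬ Δ ⊆ badVolume (N₀ + N + 1) p} ⊆
      {p | ¬ Δ ⊆ badVolume (N₀ + N) p} := fun N p hp =>
    not_subset_badVolume_anti Δ p (hN₀.trans (box_mono 2 (Nat.le_add_right _ _))) hp
  have hnull : ν (⋂ N, {p : SpinConfig (Site 2) × SpinConfig (Site 2) | ¬ Δ ⊆ badVolume (N₀ + N) p}) = 0 := by
    refine measure_mono_null (fun p hp => ?_) (ae_iff.1 hT)
    simp only [Set.mem_iInter, Set.mem_setOf_eq] at hp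
    simp only [Set.mem_setOf_eq, not_forall, not_not]
    -- some `y ∈ Δ` is exitable from every box
    have hex : ∃ y ∈ Δ, ∀ N, Exitable (zdGraph 2) (box 2 (N₀ + N)) (spinSites 1 (badConfig p)) y := by
      by_contra hno
      push Not at hno
      choose! Ny hNy using hno
      set N := Δ.sup Ny with hN
      apply hp N
      intro y hy
      unfold badVolume
      rw [mem_explVolume_iff]
      refine ⟨box_mono 2 (Nat.le_add_right _ _) (hN₀ hy), fun hexN => hNy y hy ?_⟩
      -- monotonicity from `N₀ + N` down to `N₀ + Ny y`
      have hle : Ny y ≤ N := Finset.le_sup (f := Ny) hy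
      obtain ⟨k, hk⟩ : ∃ k, N = Ny y + k := ⟨N - Ny y, by omega⟩
      rw [hk] at hexN
      clear hk hN hle
      induction k with
      | zero => simpa using hexN
      | succ k ih =>
        apply ih
        have : N₀ + (Ny y + (k + 1)) = (N₀ + (Ny y + k)) + 1 := by ring
        rw [this] at hexN
        exact exitable_mono_box hexN (box_mono 2 (by omega) (hN₀ hy))
    obtain ⟨y, hy, hyex⟩ := hex
    refine exists_infinite_of_forall_exitable (p := p) (y := y) fun N hyN => ?_
    · -- reduce an arbitrary box to the boxes `Λ_{N₀ + N}`
      by_cases hN : N₀ ≤ N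
      · obtain ⟨k, rfl⟩ : ∃ k, N = N₀ + k := ⟨N - N₀, by omega⟩
        exact hyex k
      · push Not at hN
        obtain ⟨k, hk⟩ : ∃ k, N₀ = N + k := ⟨N₀ - N, by omega⟩
        have h0 := hyex 0
        rw [Nat.add_zero, hk] at h0
        clear hk
        induction k with
        | zero => simpa using h0
        | succ k ih => exact ih (exitable_mono_box (by rw [← Nat.add_assoc] at h0; exact h0) (box_mono 2 (by omega) hyN))
  have hanti' : Antitone fun N => {p : SpinConfig (Site 2) × SpinConfig (Site 2) | ¬ Δ ⊆ badVolume (N₀ + N) p} := by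
    refine antitone_nat_of_succ_le fun N => ?_
    intro p hp
    exact hanti N (by simpa [Nat.add_assoc] using hp)
  have htend := tendsto_measure_iInter_atTop (μ := ν) (fun N => (hmeas (N₀ + N)).nullMeasurableSet)
    hanti' ⟨0, measure_ne_top ν _⟩
  rw [hnull] at htend
  -- undo the shift
  rw [← tendsto_add_atTop_iff_nat N₀]
  have : (fun n => ν {p | ¬ Δ ⊆ badVolume (n + N₀) p}) = fun n => ν {p | ¬ Δ ⊆ badVolume (N₀ + n) p} := by
    funext n; rw [add_comm]
  rw [this]
  exact htend

/-! ### The domination -/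

section Domination

variable {μ μ' : Measure (SpinConfig (Site 2))}

/-- The kernel bound on `{Γ_N = G}`: `μ^ω_G(f) ≤ μ^{ω̂}_G(f)` for increasing `G`-local `f ∈ [0,1]`,
since `ω ≤ ω̂` on the lattice outer boundary of `G`. [cite: GeorgiiHiguchi2000, Prop. 5.1 (proof: "μ^ω_Γ ≼ μ^{ω̂}_Γ")] -/
theorem lintegral_kernel_le_of_badVolume_eq (hβ : 0 ≤ β) {N : ℕ} {G Δ : Finset (Site 2)} (hΔG : Δ ⊆ G)
    {f : SpinConfig (Site 2) → ℝ} (hf : Monotone f) (hfm : Measurable f)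
    (hfΔ : ∀ σ σ', (∀ x ∈ Δ, σ x = σ' x) → f σ = f σ') (hf0 : ∀ σ, 0 ≤ f σ) (hf1 : ∀ σ, f σ ≤ 1)
    {p : SpinConfig (Site 2) × SpinConfig (Site 2)} (hp : badVolume N p = G) :
    ∫⁻ σ, ENNReal.ofReal (f σ) ∂(isingMeasure (zdGraph 2) G β 0 (.fixed p.1)) ≤
      ∫⁻ σ, ENNReal.ofReal (f σ) ∂(isingMeasure (zdGraph 2) G β 0 (.fixed p.2)) := by
  have hint : ∀ η : SpinConfig (Site 2), Integrable f (isingMeasure (zdGraph 2) G β 0 (.fixed η)) := fun η =>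
    Integrable.of_bound hfm.aestronglyMeasurable 1 (Eventually.of_forall fun σ => by
      rw [Real.norm_eq_abs, abs_of_nonneg (hf0 σ)]; exact hf1 σ)
  rw [← ofReal_integral_eq_lintegral_ofReal (hint _) (Eventually.of_forall hf0),
    ← ofReal_integral_eq_lintegral_ofReal (hint _) (Eventually.of_forall hf0)]
  refine ENNReal.ofReal_le_ofReal ?_
  have hle : ∀ z ∈ outerBoundary (zdGraph 2) G, p.1 z ≤ p.2 z := fun z hz =>
    le_of_mem_outerBoundary_badVolume (hp ▸ hz)
  exact isingExpect_fixed_le_of_le_on_outerBoundary (G := zdGraph 2) hβ G 0 hle hf hfm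
    fun σ σ' h => hfΔ σ σ' fun x hx => h x (hΔG hx)

/-- **Per-volume comparison** (strong Markov in both layers): for `Δ ⊆ G`,
`ν̂(1_{Γ_N = G} f(ω)) ≤ ν̂(1_{Γ_N = G} f(ω̂))`. [cite: GeorgiiHiguchi2000, Prop. 5.1 (proof)] -/
theorem lintegral_indicator_badVolume_eq_le (hβ : 0 ≤ β) (hμ : μ ∈ isingGibbsMeasures 2 β 0)
    (hμ' : μ' ∈ isingGibbsMeasures 2 β 0) {N : ℕ} {G Δ : Finset (Site 2)} (hΔG : Δ ⊆ G)
    {f : SpinConfig (Site 2) → ℝ} (hf : Monotone f) (hfm : Measurable f)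
    (hfΔ : ∀ σ σ', (∀ x ∈ Δ, σ x = σ' x) → f σ = f σ') (hf0 : ∀ σ, 0 ≤ f σ) (hf1 : ∀ σ, f σ ≤ 1) :
    ∫⁻ p, {p | badVolume N p = G}.indicator (fun p => ENNReal.ofReal (f p.1)) p ∂(μ.prod μ') ≤
      ∫⁻ p, {p | badVolume N p = G}.indicator (fun p => ENNReal.ofReal (f p.2)) p ∂(μ.prod μ') := by
  have hμG : IsGibbsMeasure (isingSpecification (zdGraph 2) β 0) μ := hμ
  have hμG' : IsGibbsMeasure (isingSpecification (zdGraph 2) β 0) μ' := hμ'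
  haveI := hμG.isProbabilityMeasure
  haveI := hμG'.isProbabilityMeasure
  have hγ : IsSpecification (isingSpecification (zdGraph 2) β 0) := isSpecification_isingSpecification_zd_holds 2 β 0
  set g : SpinConfig (Site 2) → ℝ≥0∞ := fun σ => ENNReal.ofReal (f σ) with hg
  have hgm : Measurable g := ENNReal.measurable_ofReal.comp hfm
  have hg1m : Measurable fun p : SpinConfig (Site 2) × SpinConfig (Site 2) => g p.1 := hgm.comp measurable_fst
  have hg2m : Measurable fun p : SpinConfig (Site 2) × SpinConfig (Site 2) => g p.2 := hgm.comp measurable_snd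
  set E : Set (SpinConfig (Site 2) × SpinConfig (Site 2)) := {p | badVolume N p = G} with hE
  have hEm : MeasurableSet E := measurableSet_badVolume_eq N G
  -- the kernel expectation `h(η) = μ^η_G(g)` and its measurability
  set h : SpinConfig (Site 2) → ℝ≥0∞ := fun η => ∫⁻ σ, g σ ∂(isingSpecification (zdGraph 2) β 0 G η) with hh
  have hhm : Measurable h :=
    hγ.measurable_lintegral_randomVolume (Γ := fun _ => G) (fun Λ => MeasurableSet.const _) hgm
  -- sections
  have hsec1 : ∀ ω', MeasurableSet[cylinderEvents (X := fun _ : Site 2 => ℤˣ) ((↑G : Set (Site 2))ᶜ)]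
      {ω : SpinConfig (Site 2) | (ω, ω') ∈ E} := fun ω' => measurableSet_badVolume_eq_left N G ω'
  have hsec2 : ∀ ω, MeasurableSet[cylinderEvents (X := fun _ : Site 2 => ℤˣ) ((↑G : Set (Site 2))ᶜ)]
      {ω' : SpinConfig (Site 2) | (ω, ω') ∈ E} := fun ω => measurableSet_badVolume_eq_right N G ω
  have hsec1m : ∀ ω', MeasurableSet {ω : SpinConfig (Site 2) | (ω, ω') ∈ E} := fun ω' => cylinderEvents_le_pi _ (hsec1 ω')
  have hsec2m : ∀ ω, MeasurableSet {ω' : SpinConfig (Site 2) | (ω, ω') ∈ E} := fun ω => cylinderEvents_le_pi _ (hsec2 ω)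
  -- left side: integrate `ω` first
  have hL : ∫⁻ p, E.indicator (fun p => g p.1) p ∂(μ.prod μ') ≤ ∫⁻ ω', h ω' * μ {ω | (ω, ω') ∈ E} ∂μ' := by
    rw [lintegral_prod_symm _ (hg1m.indicator hEm).aemeasurable]
    refine lintegral_mono fun ω' => ?_
    have hind : ∀ ω, E.indicator (fun p : SpinConfig (Site 2) × SpinConfig (Site 2) => g p.1) (ω, ω') =
        {ω : SpinConfig (Site 2) | (ω, ω') ∈ E}.indicator g ω := fun ω => by
      by_cases hω : (ω, ω') ∈ E
      · rw [Set.indicator_of_mem hω, Set.indicator_of_mem (show ω ∈ {ω | (ω, ω') ∈ E} from hω)]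
      · rw [Set.indicator_of_notMem hω, Set.indicator_of_notMem (show ω ∉ {ω | (ω, ω') ∈ E} from hω)]
    simp_rw [hind]
    rw [lintegral_indicator (hsec1m ω'), ← hμG.setLIntegral_lintegral_spec hγ G (hsec1 ω') hgm]
    calc ∫⁻ ω in {ω | (ω, ω') ∈ E}, ∫⁻ σ, g σ ∂(isingSpecification (zdGraph 2) β 0 G ω) ∂μ
        ≤ ∫⁻ ω in {ω | (ω, ω') ∈ E}, h ω' ∂μ := by
          refine setLIntegral_mono measurable_const fun ω hω => ?_
          simp only [hh, isingSpecification_apply]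
          exact lintegral_kernel_le_of_badVolume_eq hβ hΔG hf hfm hfΔ hf0 hf1 (p := (ω, ω')) hω
      _ = h ω' * μ {ω | (ω, ω') ∈ E} := setLIntegral_const _ _
  -- right side: integrate `ω̂` first, use the DLR equation for `μ̂`, then swap
  have hR : ∫⁻ p, E.indicator (fun p => g p.2) p ∂(μ.prod μ') = ∫⁻ ω', h ω' * μ {ω | (ω, ω') ∈ E} ∂μ' := by
    have h1 : ∫⁻ p, E.indicator (fun p => g p.2) p ∂(μ.prod μ') = ∫⁻ p, E.indicator (fun p => h p.2) p ∂(μ.prod μ') := by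
      have hh2m : Measurable fun p : SpinConfig (Site 2) × SpinConfig (Site 2) => h p.2 := hhm.comp measurable_snd
      rw [lintegral_prod _ (hg2m.indicator hEm).aemeasurable,
        lintegral_prod _ (hh2m.indicator hEm).aemeasurable]
      refine lintegral_congr fun ω => ?_
      have hind : ∀ (k : SpinConfig (Site 2) → ℝ≥0∞) ω', E.indicator (fun p : SpinConfig (Site 2) × SpinConfig (Site 2) => k p.2) (ω, ω') =
          {ω' : SpinConfig (Site 2) | (ω, ω') ∈ E}.indicator k ω' := fun k ω' => by
        by_cases hω : (ω, ω') ∈ E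
        · rw [Set.indicator_of_mem hω, Set.indicator_of_mem (show ω' ∈ {ω' | (ω, ω') ∈ E} from hω)]
        · rw [Set.indicator_of_notMem hω, Set.indicator_of_notMem (show ω' ∉ {ω' | (ω, ω') ∈ E} from hω)]
      simp_rw [hind]
      rw [lintegral_indicator (hsec2m ω), lintegral_indicator (hsec2m ω),
        hμG'.setLIntegral_lintegral_spec hγ G (hsec2 ω) hgm]
    have hh2m : Measurable fun p : SpinConfig (Site 2) × SpinConfig (Site 2) => h p.2 := hhm.comp measurable_snd
    rw [h1, lintegral_prod_symm _ (hh2m.indicator hEm).aemeasurable]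
    refine lintegral_congr fun ω' => ?_
    have hind : ∀ ω, E.indicator (fun p : SpinConfig (Site 2) × SpinConfig (Site 2) => h p.2) (ω, ω') =
        {ω : SpinConfig (Site 2) | (ω, ω') ∈ E}.indicator (fun _ => h ω') ω := fun ω => by
      by_cases hω : (ω, ω') ∈ E
      · rw [Set.indicator_of_mem hω, Set.indicator_of_mem (show ω ∈ {ω | (ω, ω') ∈ E} from hω)]
      · rw [Set.indicator_of_notMem hω, Set.indicator_of_notMem (show ω ∉ {ω | (ω, ω') ∈ E} from hω)]
    simp_rw [hind]
    rw [lintegral_indicator (hsec1m ω'), setLIntegral_const]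
  exact hL.trans hR.symm.le

/-- **`μ ≼ μ̂` from the absence of bad percolation** (Georgii–Higuchi 2000, proof of Prop. 5.1):
for `β ≥ 0`, `μ, μ̂ ∈ 𝒢(β, 0)`, if `μ ⊗ μ̂`-almost surely there is no infinite lattice cluster of
sites with `ω = +1, ω̂ = -1`, then `∫ f dμ ≤ ∫ f dμ̂` for every increasing local `f ∈ [0, 1]`. [cite: GeorgiiHiguchi2000, Prop. 5.1 (proof)] -/
theorem integral_le_of_no_bad_percolation (hβ : 0 ≤ β) (hμ : μ ∈ isingGibbsMeasures 2 β 0)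
    (hμ' : μ' ∈ isingGibbsMeasures 2 β 0)
    (hT : ∀ᵐ p ∂(μ.prod μ'), ∀ t, ¬ (siteCluster (zdGraph 2) (spinSites 1 (badConfig p)) t).Infinite)
    {Δ : Finset (Site 2)} {f : SpinConfig (Site 2) → ℝ} (hf : Monotone f) (hfm : Measurable f)
    (hfΔ : ∀ σ σ', (∀ x ∈ Δ, σ x = σ' x) → f σ = f σ') (hf0 : ∀ σ, 0 ≤ f σ) (hf1 : ∀ σ, f σ ≤ 1) :
    ∫ σ, f σ ∂μ ≤ ∫ σ, f σ ∂μ' := by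
  classical
  have hμG : IsGibbsMeasure (isingSpecification (zdGraph 2) β 0) μ := hμ
  have hμG' : IsGibbsMeasure (isingSpecification (zdGraph 2) β 0) μ' := hμ'
  haveI := hμG.isProbabilityMeasure
  haveI := hμG'.isProbabilityMeasure
  set ν := μ.prod μ' with hν
  set g : SpinConfig (Site 2) → ℝ≥0∞ := fun σ => ENNReal.ofReal (f σ) with hg
  have hgm : Measurable g := ENNReal.measurable_ofReal.comp hfm
  have hg1m : Measurable fun p : SpinConfig (Site 2) × SpinConfig (Site 2) => g p.1 := hgm.comp measurable_fst
  have hg2m : Measurable fun p : SpinConfig (Site 2) × SpinConfig (Site 2) => g p.2 := hgm.comp measurable_snd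
  have hg1 : ∀ σ, g σ ≤ 1 := fun σ => by rw [hg]; exact ENNReal.ofReal_le_one.2 (hf1 σ)
  -- the `ℝ≥0∞` inequality `∫⁻ g dμ ≤ ∫⁻ g dμ' + ν(Δ ⊄ Γ_N)` for every `N`
  have hN : ∀ N : ℕ, ∫⁻ σ, g σ ∂μ ≤ ∫⁻ σ, g σ ∂μ' + ν {p | ¬ Δ ⊆ badVolume N p} := by
    intro N
    set 𝒢 : Finset (Finset (Site 2)) := (box 2 N).powerset.filter fun G => Δ ⊆ G with h𝒢
    have hmem𝒢 : ∀ G, G ∈ 𝒢 ↔ G ⊆ box 2 N ∧ Δ ⊆ G := fun G => by rw [h𝒢, Finset.mem_filter, Finset.mem_powerset]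
    set D : Set (SpinConfig (Site 2) × SpinConfig (Site 2)) := {p | Δ ⊆ badVolume N p} with hD
    have hDeq : D = ⋃ G ∈ 𝒢, {p | badVolume N p = G} := by
      ext p
      simp only [hD, Set.mem_setOf_eq, Set.mem_iUnion, exists_prop]
      constructor
      · intro h; exact ⟨badVolume N p, (hmem𝒢 _).2 ⟨explVolume_subset _ _, h⟩, rfl⟩
      · rintro ⟨G, hG, rfl⟩; exact ((hmem𝒢 _).1 hG).2
    have hdisj : Set.PairwiseDisjoint (↑𝒢 : Set (Finset (Site 2))) fun G => {p : SpinConfig (Site 2) × SpinConfig (Site 2) | badVolume N p = G} := by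
      intro G _ G' _ hne
      rw [Function.onFun, Set.disjoint_iff]
      rintro p ⟨h1, h2⟩
      exact hne (h1.symm.trans h2)
    have hDm : MeasurableSet D := by
      rw [hDeq]; exact MeasurableSet.biUnion (Set.to_countable _) fun G _ => measurableSet_badVolume_eq N G
    -- `∫⁻ g ∘ fst` and `∫⁻ g ∘ snd` over `D` as sums over `G`
    have hsum : ∀ (k : SpinConfig (Site 2) × SpinConfig (Site 2) → ℝ≥0∞), Measurable k →
        ∫⁻ p in D, k p ∂ν = ∑ G ∈ 𝒢, ∫⁻ p, {p | badVolume N p = G}.indicator k p ∂ν := by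
      intro k hk
      rw [hDeq, lintegral_biUnion_finset hdisj fun G _ => measurableSet_badVolume_eq N G]
      exact Finset.sum_congr rfl fun G _ => (lintegral_indicator (measurableSet_badVolume_eq N G) _).symm
    have hfst : ∫⁻ σ, g σ ∂μ = ∫⁻ p, g p.1 ∂ν := by
      rw [hν, lintegral_prod _ hg1m.aemeasurable]
      simp [lintegral_const, measure_univ]
    have hsnd : ∫⁻ p, g p.2 ∂ν = ∫⁻ σ, g σ ∂μ' := by
      rw [hν, lintegral_prod _ hg2m.aemeasurable]
      simp only [lintegral_const, measure_univ, mul_one]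
    calc ∫⁻ σ, g σ ∂μ = ∫⁻ p, g p.1 ∂ν := hfst
      _ = ∫⁻ p in D, g p.1 ∂ν + ∫⁻ p in Dᶜ, g p.1 ∂ν := (lintegral_add_compl _ hDm).symm
      _ ≤ (∑ G ∈ 𝒢, ∫⁻ p, {p | badVolume N p = G}.indicator (fun p => g p.1) p ∂ν) + ν Dᶜ := by
          rw [hsum _ hg1m]
          refine add_le_add le_rfl ?_
          calc ∫⁻ p in Dᶜ, g p.1 ∂ν ≤ ∫⁻ _p in Dᶜ, 1 ∂ν := lintegral_mono fun p => hg1 p.1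
            _ = ν Dᶜ := by rw [setLIntegral_const, one_mul]
      _ ≤ (∑ G ∈ 𝒢, ∫⁻ p, {p | badVolume N p = G}.indicator (fun p => g p.2) p ∂ν) + ν Dᶜ := by
          refine add_le_add (Finset.sum_le_sum fun G hG => ?_) le_rfl
          exact lintegral_indicator_badVolume_eq_le hβ hμ hμ' ((hmem𝒢 G).1 hG).2 hf hfm hfΔ hf0 hf1
      _ = ∫⁻ p in D, g p.2 ∂ν + ν Dᶜ := by rw [hsum _ hg2m]
      _ ≤ ∫⁻ p, g p.2 ∂ν + ν {p | ¬ Δ ⊆ badVolume N p} := by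
          refine add_le_add (setLIntegral_le_lintegral _ _) (le_of_eq ?_)
          rfl
      _ = ∫⁻ σ, g σ ∂μ' + ν {p | ¬ Δ ⊆ badVolume N p} := by rw [hsnd]
  -- let `N → ∞`
  have hlim : ∫⁻ σ, g σ ∂μ ≤ ∫⁻ σ, g σ ∂μ' := by
    have ht := tendsto_measure_not_subset_badVolume ν hT Δ
    have ht' : Tendsto (fun N => ∫⁻ σ, g σ ∂μ' + ν {p | ¬ Δ ⊆ badVolume N p}) atTop (𝓝 (∫⁻ σ, g σ ∂μ' + 0)) :=
      ht.const_add _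
    rw [add_zero] at ht'
    exact ge_of_tendsto' ht' hN
  -- back to real integrals
  have hint : ∀ κ : Measure (SpinConfig (Site 2)), IsProbabilityMeasure κ → Integrable f κ := fun κ _ =>
    Integrable.of_bound hfm.aestronglyMeasurable 1 (Eventually.of_forall fun σ => by
      rw [Real.norm_eq_abs, abs_of_nonneg (hf0 σ)]; exact hf1 σ)
  rw [integral_eq_lintegral_of_nonneg_ae (Eventually.of_forall hf0) hfm.aestronglyMeasurable,
    integral_eq_lintegral_of_nonneg_ae (Eventually.of_forall hf0) hfm.aestronglyMeasurable]
  refine ENNReal.toReal_mono ?_ hlim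
  refine ne_of_lt (lt_of_le_of_lt (lintegral_mono fun σ => hg1 σ) ?_)
  rw [lintegral_const, measure_univ, mul_one]; exact ENNReal.one_lt_top

/-- **Equality of Gibbs measures from the absence of bad percolation in both directions**
(Georgii–Higuchi 2000, end of the proof of Prop. 5.1: "Interchanging `μ` and `μ̂` we get the
reverse relation. Hence `μ = μ̂`"). [cite: GeorgiiHiguchi2000, Prop. 5.1 (proof)] -/
theorem eq_of_no_bad_percolation (hβ : 0 ≤ β) (hμ : μ ∈ isingGibbsMeasures 2 β 0)
    (hμ' : μ' ∈ isingGibbsMeasures 2 β 0)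
    (hT : ∀ᵐ p ∂(μ.prod μ'), ∀ t, ¬ (siteCluster (zdGraph 2) (spinSites 1 (badConfig p)) t).Infinite)
    (hT' : ∀ᵐ p ∂(μ'.prod μ), ∀ t, ¬ (siteCluster (zdGraph 2) (spinSites 1 (badConfig p)) t).Infinite) :
    μ = μ' := by
  have hμG : IsGibbsMeasure (isingSpecification (zdGraph 2) β 0) μ := hμ
  have hμG' : IsGibbsMeasure (isingSpecification (zdGraph 2) β 0) μ' := hμ'
  haveI := hμG.isProbabilityMeasure
  haveI := hμG'.isProbabilityMeasure
  refine measure_eq_of_forall_integral_plusIndicator_eq μ μ' fun S => le_antisymm ?_ ?_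
  · exact integral_le_of_no_bad_percolation hβ hμ hμ' hT (plusIndicator_mono S) (measurable_plusIndicator S)
      (fun σ σ' h => dependsOn_plusIndicator' S h) (plusIndicator_nonneg S) (plusIndicator_le_one' S)
  · exact integral_le_of_no_bad_percolation hβ hμ' hμ hT' (plusIndicator_mono S) (measurable_plusIndicator S)
      (fun σ σ' h => dependsOn_plusIndicator' S h) (plusIndicator_nonneg S) (plusIndicator_le_one' S)

end Domination

end Literature.Probability.LatticeModels
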